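import Mathlib.NumberTheory.ModularForms.QExpansion
import Mathlib.NumberTheory.ModularForms.Identities
import HarnessLib

/-!
# The zeroth Fourier coefficient of a cusp form at an arbitrary cusp vanishes, as an integral

Topic `NumberTheory/Automorphic`; the classical input of the cuspidality of the adelic lift
`φ_f` of a cusp form (Gelbart (1975), Prop. 3.1 (vii), whose real-group version is his condition
2.4 (iv), pp. 16–17: `∫₀¹ φ_f(σ n(xh) g) dx = ∫₀¹ (f|[σ]_k)(hx + z) dx` "is simply the zeroth
Fourier coefficient of `f` at the cusp `s = σ(∞)`", hence `0` for a cusp form).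

For a cusp form `f` of weight `k` and level `Γ ≤ GL₂(ℝ)` (Mathlib `CuspFormClass F Γ k`), any
`g ∈ GL₂(ℝ)` and any `h > 0` with `g n(h) g⁻¹ ∈ Γ` (`n(h) = upperRightHom h = (1 h; 0 1)`), i.e.
`h` a strict period of the conjugate `g⁻¹ Γ g`, we prove

* `intervalIntegral_slash_mk_eq_zero`: `∫₀ʰ (f ∣[k] g)(u + it) du = 0` for every `t > 0`;
* `intervalIntegral_slash_vadd_eq_zero`: `∫ₐ^{a+h} (f ∣[k] g)(u + τ) du = 0` for all `τ ∈ ℍ`, `a ∈ ℝ`;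
* `intervalIntegral_slash_neg_vadd_eq_zero`: `∫ₐ^{a+h} (f ∣[k] g)(τ - u) du = 0`.

Everything is Mathlib: `f ∣[k] g` is the cusp form `CuspForm.translate f g` of level `g⁻¹ Γ g`, its
`q`-expansion in `e^{2πiτ/h}` has vanishing constant term (`CuspFormClass.qExpansion_coeff_zero`)
and that constant term is `h⁻¹ ∫₀ʰ (f ∣[k] g)(u + it) du`
(`ModularFormClass.qExpansion_coeff_eq_intervalIntegral`); the shifts in `u` use the
`h`-periodicity (`SlashInvariantForm.vAdd_apply_of_mem_strictPeriods`,
`Function.Periodic.intervalIntegral_add_eq`).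

## References

* S. Gelbart, *Automorphic forms on adele groups*, Ann. of Math. Stud. 83 (1975), §2, (2.4)(iv) and
  pp. 16–17; §3.A, Prop. 3.1 (vii) [Gelbart1975].
-/

noncomputable section

open UpperHalfPlane MeasureTheory Matrix.GeneralLinearGroup
open scoped MatrixGroups ModularForm Pointwise

namespace Literature.NumberTheory.Automorphic

variable {Γ : Subgroup (GL (Fin 2) ℝ)} {k : ℤ} {F : Type*} [FunLike F ℍ ℂ]

/-- If `g n(h) g⁻¹ ∈ Γ` then `h` is a strict period of the conjugate subgroup `g⁻¹ Γ g`
(`ConjAct.toConjAct g⁻¹ • Γ`, the level of `CuspForm.translate f g`). [folklore] -/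
theorem mem_strictPeriods_conj {g : GL (Fin 2) ℝ} {h : ℝ} (hΓ : g * upperRightHom h * g⁻¹ ∈ Γ) :
    h ∈ (ConjAct.toConjAct g⁻¹ • Γ).strictPeriods := by
  rw [Subgroup.mem_strictPeriods_iff, map_inv, Subgroup.mem_inv_pointwise_smul_iff,
    ConjAct.toConjAct_smul]
  exact hΓ

/-- The underlying function of `CuspForm.translate f g` is `f ∣[k] g` (definitional). [folklore] -/
theorem coe_cuspForm_translate [CuspFormClass F Γ k] (f : F) (g : GL (Fin 2) ℝ) :
    ⇑(CuspForm.translate f g) = ⇑f ∣[k] g :=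
  rfl

/-- **The zeroth Fourier coefficient of a cusp form at the cusp `g ∞` vanishes** (Gelbart (1975),
pp. 16–17, condition 2.4 (iv); Def. 1.4): for `f ∈ S_k(Γ)`, `g ∈ GL₂(ℝ)` and `h > 0` with
`g n(h) g⁻¹ ∈ Γ`, `∫₀ʰ (f ∣[k] g)(u + it) du = 0` for every `t > 0`. [cite: Gelbart1975, §2 (2.4)(iv), pp. 16–17] -/
theorem intervalIntegral_slash_mk_eq_zero [CuspFormClass F Γ k] (f : F) (g : GL (Fin 2) ℝ) {h : ℝ}
    (hh : 0 < h) (hΓ : g * upperRightHom h * g⁻¹ ∈ Γ) {t : ℝ} (ht : 0 < t) :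
    ∫ u in (0 : ℝ)..h, (⇑f ∣[k] g) ⟨u + t * Complex.I, by simpa using ht⟩ = 0 := by
  have hper := mem_strictPeriods_conj (Γ := Γ) hΓ
  have h1 := ModularFormClass.qExpansion_coeff_eq_intervalIntegral
    (CuspForm.translate f g) hh hper 0 ht
  rw [CuspFormClass.qExpansion_coeff_zero (CuspForm.translate f g) hh hper] at h1
  simp only [pow_zero, div_one, one_mul, coe_cuspForm_translate] at h1
  rcases mul_eq_zero.1 h1.symm with h0 | h0
  · exact absurd h0 (one_div_ne_zero (Complex.ofReal_ne_zero.2 hh.ne'))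
  · exact h0

/-- The translate `u ↦ (f ∣[k] g)(u + τ)` along the horizontal line through `τ`. [folklore] -/
theorem slash_vadd_eq_slash_mk (f : ℍ → ℂ) (g : GL (Fin 2) ℝ) (τ : ℍ) (u : ℝ) :
    (f ∣[k] g) (u +ᵥ τ) =
      (f ∣[k] g) ⟨((u + τ.re : ℝ) : ℂ) + τ.im * Complex.I, by simpa using τ.im_pos⟩ := by
  refine congrArg (f ∣[k] g) (UpperHalfPlane.ext ?_)
  rw [coe_vadd]
  apply Complex.ext <;> simp

/-- `u ↦ (f ∣[k] g)(u + τ)` is `h`-periodic when `g n(h) g⁻¹ ∈ Γ`. [folklore] -/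
theorem periodic_slash_vadd [SlashInvariantFormClass F Γ k] (f : F) (g : GL (Fin 2) ℝ) {h : ℝ}
    (hΓ : g * upperRightHom h * g⁻¹ ∈ Γ) (τ : ℍ) :
    Function.Periodic (fun u : ℝ => (⇑f ∣[k] g) (u +ᵥ τ)) h := by
  intro u
  have hper := mem_strictPeriods_conj (Γ := Γ) hΓ
  have e : (u + h) +ᵥ τ = h +ᵥ (u +ᵥ τ) := by
    apply UpperHalfPlane.ext
    simp only [coe_vadd]
    push_cast
    ring
  change (⇑f ∣[k] g) ((u + h) +ᵥ τ) = (⇑f ∣[k] g) (u +ᵥ τ)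
  rw [e]
  exact SlashInvariantForm.vAdd_apply_of_mem_strictPeriods (SlashInvariantForm.translate f g) (u +ᵥ τ) hper

/-- **Vanishing of the zeroth Fourier coefficient at the cusp `g ∞`, translated form**: for
`f ∈ S_k(Γ)`, `g n(h) g⁻¹ ∈ Γ`, `h > 0`, every `τ ∈ ℍ` and `a ∈ ℝ`,
`∫ₐ^{a+h} (f ∣[k] g)(u + τ) du = 0` (Gelbart (1975), pp. 16–17: `∫₀¹ (f|[σ]_k)(hx + z) dx = 0`).
[cite: Gelbart1975, §2 (2.4)(iv), pp. 16–17] -/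
theorem intervalIntegral_slash_vadd_eq_zero [CuspFormClass F Γ k] (f : F) (g : GL (Fin 2) ℝ) {h : ℝ}
    (hh : 0 < h) (hΓ : g * upperRightHom h * g⁻¹ ∈ Γ) (τ : ℍ) (a : ℝ) :
    ∫ u in a..a + h, (⇑f ∣[k] g) (u +ᵥ τ) = 0 := by
  set G : ℝ → ℂ := fun u => (⇑f ∣[k] g) ⟨(u : ℂ) + τ.im * Complex.I, by simpa using τ.im_pos⟩
    with hG
  have hpt : (fun u : ℝ => (⇑f ∣[k] g) (u +ᵥ τ)) = fun u => G (u + τ.re) := by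
    funext u
    rw [hG, slash_vadd_eq_slash_mk]
  have hp := periodic_slash_vadd f g hΓ τ
  rw [hp.intervalIntegral_add_eq a (-τ.re), hpt, intervalIntegral.integral_comp_add_right G τ.re,
    show -τ.re + τ.re = 0 by ring, show -τ.re + h + τ.re = h by ring, hG]
  exact intervalIntegral_slash_mk_eq_zero f g hh hΓ τ.im_pos

/-- The same with `τ - u`: `∫ₐ^{a+h} (f ∣[k] g)(τ - u) du = 0`. [cite: Gelbart1975, §2 (2.4)(iv), pp. 16–17] -/
theorem intervalIntegral_slash_neg_vadd_eq_zero [CuspFormClass F Γ k] (f : F) (g : GL (Fin 2) ℝ)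
    {h : ℝ} (hh : 0 < h) (hΓ : g * upperRightHom h * g⁻¹ ∈ Γ) (τ : ℍ) (a : ℝ) :
    ∫ u in a..a + h, (⇑f ∣[k] g) ((-u) +ᵥ τ) = 0 := by
  rw [intervalIntegral.integral_comp_neg (fun u : ℝ => (⇑f ∣[k] g) (u +ᵥ τ))]
  have := intervalIntegral_slash_vadd_eq_zero f g hh hΓ τ (-(a + h))
  rwa [show -(a + h) + h = -a by ring] at this

end Literature.NumberTheory.Automorphic
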